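import Summits.QuantumFields.BalabanUV.Beta.EriceRemainderEnclosureHistoryAutonomyComparisonAgeCompositionYoungestTailSumFlow
import Summits.QuantumFields.BalabanUV.Beta.EriceRemainderEnclosureHistoryAutonomyComparisonAgeCompositionStaticEndSharpFlow

/-!
# EriceRemainderEnclosureHistoryAutonomyComparisonAgeCompositionYoungestTailSumWiring — (E82c) route (N), first order: the two-age chain at the youngest age
# collapses (`β 2 n k = x̃_k(n)∕(1 − x̃_k(n))`, `Hg 1 n = (1 + θ_k(n;1)·x̃∕(1−x̃))∕(1 − KL k n 0)`, `M 1 m = KL 1 m 0`), so (E82b)'s kernel inequality IS the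
# age-`1` instance of the hypotheses `hSb` ∧ `hSbp` of (E81k) `flow_nonneg_of_sharp_static_families` — verbatim, along every two-age flow

Cell `pub-balaban`, β-function sub-cell, BINDER row D4 «RemainderConst leaves for Bałaban's split» (`HOME/BINDER-OWNERS.md`; owner lineage `b2b-balaban-beta-an4`;
this file by co-owner #2 lineage `b2b-balaban-beta-d4-p2`, generation 73), β-FLOW TEAM duty (1), FREEZE (0) honoured (def-free; imports (E82b)
`…YoungestTailSumFlow` and (E81k) `…StaticEndSharpFlow`; uses `flow_youngest_tail_sum_two_ages`, `kernel_entry_le`,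
`flow_nonneg_of_sharp_static_families` BY NAME; the chain letters `ρ`, `β`, `Hg`, `M` are displayed hypotheses
on bound variables exactly as in (E81k); nothing restated).

HONEST FRAMING (page 1, verbatim and binding).  *"Discharging BetaPertH makes Bałaban's UV stability UNCONDITIONAL — a real constructive-QFT result; it is
NOT the continuum limit and NOT the Clay problem."*  THIS FILE DISCHARGES NOTHING OF THE KIND.  Elementary bookkeeping about the FIRST-ORDER renewal objects
of route (N) — hypotheses of a census, not facts; the age profile of Bałaban's (1.22) limit functional is NOT PRINTED ([I] p. 298; GAPS G-t4-U2-1∕-2) and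
NOT asserted.  Row D4 class UNCHANGED (critical-path width 0; instance 0∕1; D4 DISCHARGE NO DATE).  HONEST DEPENDENCY: continuum YM on T⁴ ⇐ BetaPertH ∧
nine spine estimates (0/9 proved); BetaPertH ⇐ (D1) ∧ (D4) ∧ CAP+tail; G-an2-4 gates asym, D1 and NE2/3/4.

THE POINT (census sense (α); route (N); README `g73/e82/README.md`).  For a two-age profile `{1, k}` (`L_j = 0` for `j ∉ {1, k}`) the static chain of (E80e)
(`hρ`, `hβnew`, `hβold` of (E81k)) has `ρ j n = 0` and `β i n j = 0` for every silent age `j` (`kernel_zero`, `rho_zero`, `beta_zero`), `ρ k n = x̃_k(n)`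
(`rho_old`), `β i n k = ρ k n∕(1 − ρ k n)` down to `i = 2` (`beta_old`); hence `Hg 1 n` and `M 1 m` of (E81k) are the explicit factors of (E82b)
(`Hg_one`, `M_one`), and **`flow_hSb_one`**: the age-`1` instances of (E81k)'s `hSb` and `hSbp` hold along every two-age flow, for every damping in the
relaxed class.  NOT CLAIMED: the instances `i = k` of `hSb`∕`hSbp` (the old age's own tail sums — README `g72/e81` §2: thin for long saturated windows
with the first-order majorant), (S-a), (S-c♯); three or more ages; anything printed.

WHAT IS PROVED ([folklore]; 0 `def`, 0 sorry).  §1–§2 `kernel_zero`, `rho_zero`, `beta_zero`, `rho_old`, `beta_old`, `Hg_one`, `M_one`; §3 **`flow_hSb_one`**;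
§4 **`flow_nonneg_two_ages_of_old_families`** ((E81k)'s END for two-age flows with `hSb`∕`hSbp` asked only for the ages `≥ 2`).
-/
noncomputable section
open Finset

namespace Summit.QuantumFields.BalabanUV.Beta.EriceRemainderEnclosureHistoryAutonomyComparisonAgeCompositionYoungestTailSumWiring

open Literature.MathematicalPhysics.QuantumFieldTheory.Balaban1983to89
open Literature.MathematicalPhysics.QuantumFieldTheory.Balaban1983to89.T4BetaStationary
open Literature.MathematicalPhysics.QuantumFieldTheory.Balaban1983to89.T4BetaFlowWellPosed
open Summit.QuantumFields.BalabanUV.Beta.EriceRemainderEnclosureHistoryAutonomyComparisonAgeCompositionYoungestTailSumFlow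
open Summit.QuantumFields.BalabanUV.Beta.EriceRemainderEnclosureHistoryAutonomyComparisonAgeCompositionStaticEndSharpFlow (flow_nonneg_of_sharp_static_families)

variable {B : (ℕ → ℝ) → ℝ} {γ b gIR : ℝ} {L : ℕ → ℝ} {K : ℕ} {h g : ℕ → ℝ} {KL θ : ℕ → ℕ → ℕ → ℝ}
  {ρ : ℕ → ℕ → ℝ} {β : ℕ → ℕ → ℕ → ℝ} {Hg M : ℕ → ℕ → ℝ}

/-! ## §1 Silent ages drop out of the chain -/

/-- A silent age (`L_j = 0`) has the zero kernel. [folklore] -/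
theorem kernel_zero
    (hKL : ∀ k n l, KL k n l = if 0 < k ∧ k < K ∧ l < k then L k * h (n + k) ^ 3 / 2 * ∏ t ∈ Ico (n + 1 + l) (n + k + 1), g t else 0)
    {j : ℕ} (hj : L j = 0) (n l : ℕ) : KL j n l = 0 := by
  rw [hKL]; split_ifs <;> simp [hj]

/-- A silent age has the zero chain ratio `ρ j n = 0`. [folklore] -/
theorem rho_zero
    (hKL : ∀ k n l, KL k n l = if 0 < k ∧ k < K ∧ l < k then L k * h (n + k) ^ 3 / 2 * ∏ t ∈ Ico (n + 1 + l) (n + k + 1), g t else 0)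
    (hρ : ∀ i n, 1 ≤ i → i ≤ K - 1 → ρ i n = (∑ l ∈ range K, KL i n l) * (1 + ∑ k ∈ Ioc i (K - 1), θ k n i * β (i + 1) n k) /
      (1 - ∑ k ∈ Ioc i (K - 1), ∑ l ∈ range i, KL k n l))
    {j : ℕ} (hj : L j = 0) (hj1 : 1 ≤ j) (hjK : j ≤ K - 1) (n : ℕ) : ρ j n = 0 := by
  rw [hρ j n hj1 hjK, sum_eq_zero fun l _ => kernel_zero hKL hj n l, zero_mul, zero_div]

/-- A silent age carries no ratio: `β i n j = 0` for `1 ≤ i ≤ j`. [folklore] -/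
theorem beta_zero
    (hKL : ∀ k n l, KL k n l = if 0 < k ∧ k < K ∧ l < k then L k * h (n + k) ^ 3 / 2 * ∏ t ∈ Ico (n + 1 + l) (n + k + 1), g t else 0)
    (hρ : ∀ i n, 1 ≤ i → i ≤ K - 1 → ρ i n = (∑ l ∈ range K, KL i n l) * (1 + ∑ k ∈ Ioc i (K - 1), θ k n i * β (i + 1) n k) /
      (1 - ∑ k ∈ Ioc i (K - 1), ∑ l ∈ range i, KL k n l))
    (hβnew : ∀ i n, 1 ≤ i → i ≤ K - 1 → β i n i = ρ i n / (1 - ρ i n))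
    (hβold : ∀ i n k, 1 ≤ i → i < k → k ≤ K - 1 → β i n k = β (i + 1) n k / (1 - ρ i n))
    {j : ℕ} (hj : L j = 0) (hjK : j ≤ K - 1) (n : ℕ) : ∀ i, 1 ≤ i → i ≤ j → β i n j = 0 := by
  suffices hd : ∀ d i, i + d = j → 1 ≤ i → β i n j = 0 from fun i hi1 hij => hd (j - i) i (by omega) hi1
  intro d
  induction d with
  | zero =>
    intro i hi hi1
    rw [add_zero] at hi; subst hi
    rw [hβnew i n hi1 hjK, rho_zero hKL hρ hj hi1 hjK n, zero_div]
  | succ d ih =>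
    intro i hi hi1
    rw [hβold i n j hi1 (by omega) hjK, ih (i + 1) (by omega) (by omega), zero_div]

/-! ## §2 The two-age chain at the youngest age -/

/-- For the two-age profile `{1, k}` the OLD age's chain ratio is its damped row mass: `ρ k n = x̃_k(n) = Σ_l KL k n l` (no older ages). [folklore] -/
theorem rho_old
    (hKL : ∀ k n l, KL k n l = if 0 < k ∧ k < K ∧ l < k then L k * h (n + k) ^ 3 / 2 * ∏ t ∈ Ico (n + 1 + l) (n + k + 1), g t else 0)
    (hρ : ∀ i n, 1 ≤ i → i ≤ K - 1 → ρ i n = (∑ l ∈ range K, KL i n l) * (1 + ∑ k ∈ Ioc i (K - 1), θ k n i * β (i + 1) n k) /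
      (1 - ∑ k ∈ Ioc i (K - 1), ∑ l ∈ range i, KL k n l))
    (hβnew : ∀ i n, 1 ≤ i → i ≤ K - 1 → β i n i = ρ i n / (1 - ρ i n))
    (hβold : ∀ i n k, 1 ≤ i → i < k → k ≤ K - 1 → β i n k = β (i + 1) n k / (1 - ρ i n))
    {k : ℕ} (hk2 : 2 ≤ k) (hkK : k < K) (hL2 : ∀ j, j < K → j ≠ 1 → j ≠ k → L j = 0) (n : ℕ) :
    ρ k n = ∑ l ∈ range K, KL k n l := by
  rw [hρ k n (by omega) (by omega)]
  have h1 : ∑ j ∈ Ioc k (K - 1), θ j n k * β (k + 1) n j = 0 := by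
    refine sum_eq_zero fun j hj => ?_
    rw [mem_Ioc] at hj
    rw [beta_zero hKL hρ hβnew hβold (hL2 j (by omega) (by omega) (by omega)) hj.2 n (k + 1) (by omega) (by omega), mul_zero]
  have h2 : ∑ j ∈ Ioc k (K - 1), ∑ l ∈ range k, KL j n l = 0 := by
    refine sum_eq_zero fun j hj => sum_eq_zero fun l _ => ?_
    rw [mem_Ioc] at hj
    exact kernel_zero hKL (hL2 j (by omega) (by omega) (by omega)) n l
  rw [h1, h2]; ring

/-- For the two-age profile the carried ratio of the old age is the same at every younger stage down to `i = 2`: `β i n k = ρ k n∕(1 − ρ k n)` for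
`2 ≤ i ≤ k` (the silent ages in between divide by `1 − 0`). [folklore] -/
theorem beta_old
    (hKL : ∀ k n l, KL k n l = if 0 < k ∧ k < K ∧ l < k then L k * h (n + k) ^ 3 / 2 * ∏ t ∈ Ico (n + 1 + l) (n + k + 1), g t else 0)
    (hρ : ∀ i n, 1 ≤ i → i ≤ K - 1 → ρ i n = (∑ l ∈ range K, KL i n l) * (1 + ∑ k ∈ Ioc i (K - 1), θ k n i * β (i + 1) n k) /
      (1 - ∑ k ∈ Ioc i (K - 1), ∑ l ∈ range i, KL k n l))
    (hβnew : ∀ i n, 1 ≤ i → i ≤ K - 1 → β i n i = ρ i n / (1 - ρ i n))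
    (hβold : ∀ i n k, 1 ≤ i → i < k → k ≤ K - 1 → β i n k = β (i + 1) n k / (1 - ρ i n))
    {k : ℕ} (hk2 : 2 ≤ k) (hkK : k < K) (hL2 : ∀ j, j < K → j ≠ 1 → j ≠ k → L j = 0) (n : ℕ) :
    ∀ i, 2 ≤ i → i ≤ k → β i n k = ρ k n / (1 - ρ k n) := by
  suffices hd : ∀ d i, i + d = k → 2 ≤ i → β i n k = ρ k n / (1 - ρ k n) from fun i hi2 hik => hd (k - i) i (by omega) hi2
  intro d
  induction d with
  | zero =>
    intro i hi _
    rw [add_zero] at hi; subst hi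
    exact hβnew i n (by omega) (by omega)
  | succ d ih =>
    intro i hi hi2
    rw [hβold i n k (by omega) (by omega) (by omega), ih (i + 1) (by omega) (by omega),
      rho_zero hKL hρ (hL2 i (by omega) (by omega) (by omega)) (by omega) (by omega) n, sub_zero, div_one]

/-- For the two-age profile the growth factor of (E81k) at the youngest age is explicit:
`Hg 1 n = (1 + θ k n 1·x̃_k(n)∕(1 − x̃_k(n)))∕(1 − KL k n 0)`. [folklore] -/
theorem Hg_one
    (hKL : ∀ k n l, KL k n l = if 0 < k ∧ k < K ∧ l < k then L k * h (n + k) ^ 3 / 2 * ∏ t ∈ Ico (n + 1 + l) (n + k + 1), g t else 0)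
    (hρ : ∀ i n, 1 ≤ i → i ≤ K - 1 → ρ i n = (∑ l ∈ range K, KL i n l) * (1 + ∑ k ∈ Ioc i (K - 1), θ k n i * β (i + 1) n k) /
      (1 - ∑ k ∈ Ioc i (K - 1), ∑ l ∈ range i, KL k n l))
    (hβnew : ∀ i n, 1 ≤ i → i ≤ K - 1 → β i n i = ρ i n / (1 - ρ i n))
    (hβold : ∀ i n k, 1 ≤ i → i < k → k ≤ K - 1 → β i n k = β (i + 1) n k / (1 - ρ i n))
    (hH : ∀ i m, Hg i m = (1 + ∑ k ∈ Ioc i (K - 1), θ k m 1 * β (i + 1) m k) / (1 - ∑ k ∈ Ioc i (K - 1), KL k m 0))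
    {k : ℕ} (hk2 : 2 ≤ k) (hkK : k < K) (hL2 : ∀ j, j < K → j ≠ 1 → j ≠ k → L j = 0) (n : ℕ) :
    Hg 1 n = (1 + θ k n 1 * ((∑ l ∈ range K, KL k n l) / (1 - ∑ l ∈ range K, KL k n l))) / (1 - KL k n 0) := by
  have hkmem : k ∈ Ioc 1 (K - 1) := by rw [mem_Ioc]; omega
  have h1 : ∑ j ∈ Ioc 1 (K - 1), θ j n 1 * β (1 + 1) n j = θ k n 1 * β 2 n k := by
    rw [sum_eq_single_of_mem k hkmem fun j hj hjk => ?_]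
    rw [mem_Ioc] at hj
    rw [show (1 : ℕ) + 1 = 2 by rfl, beta_zero hKL hρ hβnew hβold (hL2 j (by omega) (by omega) hjk) hj.2 n 2 (by omega) (by omega), mul_zero]
  have h2 : ∑ j ∈ Ioc 1 (K - 1), KL j n 0 = KL k n 0 := by
    rw [sum_eq_single_of_mem k hkmem fun j hj hjk => ?_]
    rw [mem_Ioc] at hj
    exact kernel_zero hKL (hL2 j (by omega) (by omega) hjk) n 0
  rw [hH, h1, h2, beta_old hKL hρ hβnew hβold hk2 hkK hL2 n 2 le_rfl hk2, rho_old hKL hρ hβnew hβold hk2 hkK hL2 n]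

/-- The shift-domination defect of (E81k) at the youngest age is its lag-zero entry: `M 1 m = KL 1 m 0` (the age `1` has no lag `≥ 1`). [folklore] -/
theorem M_one (hL : ∀ k, 0 ≤ L k) (hh : SeqBox γ h) (hg : ∀ t, 0 < g t ∧ g t ≤ 1)
    (hKL : ∀ k n l, KL k n l = if 0 < k ∧ k < K ∧ l < k then L k * h (n + k) ^ 3 / 2 * ∏ t ∈ Ico (n + 1 + l) (n + k + 1), g t else 0)
    (hM : ∀ i m, M i m = KL i m 0 + ∑ l ∈ range (K - 1), max (KL i m (l + 1) - KL i (m + 1) l) 0) (m : ℕ) : M 1 m = KL 1 m 0 := by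
  rw [hM, sum_eq_zero fun l _ => ?_, add_zero]
  have h0 : KL 1 m (l + 1) = 0 := by rw [hKL, if_neg]; omega
  rw [h0, zero_sub, max_eq_right]
  linarith [(kernel_entry_le hL hh hg hKL 1 (m + 1) l).1]

/-! ## §3 The age-one instance of (E81k)'s `hSb` ∧ `hSbp` along every two-age flow -/

/-- **THE AGE-ONE INSTANCE OF (S-b) HOLDS ALONG EVERY TWO-AGE FLOW.**  In the setting of (E81k) `flow_nonneg_of_sharp_static_families` restricted to a
two-age profile `{1, k}` (`2 ≤ k < K`, `L_j = 0` otherwise; any damping in the relaxed class; the chain `ρ`, `β`, the growth factors `Hg` and the defects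
`M` displayed exactly as there), the hypotheses `hSb` and `hSbp` hold at `i = 1`: for every pin `m`, `(1 + M 1 m)·Σ_{l∈[L',1)} Hg 1 (m+1+l)·KL 1 (m+1) l ≤
Σ_{l∈[L',1)} KL 1 m l` (`L' < 1`) and the partial-window variant (`L₀ < 1`, `L' ≤ L₀`) — by `Hg_one`, `M_one` and (E82b) `flow_youngest_tail_sum_two_ages`.
[folklore] -/
theorem flow_hSb_one (hmono : ∀ u v : ℕ → ℝ, SeqBox γ u → SeqBox γ v → (∀ j, u j ≤ v j) → B u ≤ B v)
    (hL : ∀ k, 0 ≤ L k) (hb : 0 < b) (hlo : ∀ u, SeqBox γ u → b ≤ B u) (hdom : ∀ u, SeqBox γ u → ∑ k ∈ range K, L k * u k ≤ B u)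
    (hh : SeqBox γ h) (hf : MemFlow B gIR h)
    (hg : ∀ t, 0 < g t ∧ g t ≤ 1) (hgF : ∀ t, 1 / (1 + ∑ k ∈ range K, L k * h (t + k) ^ 3 / 2) ≤ g t)
    {k : ℕ} (hk2 : 2 ≤ k) (hkK : k < K) (hL2 : ∀ j, j < K → j ≠ 1 → j ≠ k → L j = 0)
    (hKL : ∀ k n l, KL k n l = if 0 < k ∧ k < K ∧ l < k then L k * h (n + k) ^ 3 / 2 * ∏ t ∈ Ico (n + 1 + l) (n + k + 1), g t else 0)
    (hθ : ∀ k n l, θ k n l = 1 - (h (n + k + l) / h (n + k)) ^ 3 * ∏ t ∈ Ico (n + k + 1) (n + k + l + 1), g t)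
    (hρ : ∀ i n, 1 ≤ i → i ≤ K - 1 → ρ i n = (∑ l ∈ range K, KL i n l) * (1 + ∑ k ∈ Ioc i (K - 1), θ k n i * β (i + 1) n k) /
      (1 - ∑ k ∈ Ioc i (K - 1), ∑ l ∈ range i, KL k n l))
    (hβnew : ∀ i n, 1 ≤ i → i ≤ K - 1 → β i n i = ρ i n / (1 - ρ i n))
    (hβold : ∀ i n k, 1 ≤ i → i < k → k ≤ K - 1 → β i n k = β (i + 1) n k / (1 - ρ i n))
    (hH : ∀ i m, Hg i m = (1 + ∑ k ∈ Ioc i (K - 1), θ k m 1 * β (i + 1) m k) / (1 - ∑ k ∈ Ioc i (K - 1), KL k m 0))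
    (hM : ∀ i m, M i m = KL i m 0 + ∑ l ∈ range (K - 1), max (KL i m (l + 1) - KL i (m + 1) l) 0) :
    (∀ m L', L' < 1 → (1 + M 1 m) * ∑ l ∈ Ico L' 1, Hg 1 (m + 1 + l) * KL 1 (m + 1) l ≤ ∑ l ∈ Ico L' 1, KL 1 m l) ∧
    (∀ m L₀, L₀ < 1 → ∀ L', L' ≤ L₀ →
      (1 + M 1 m) * ∑ l ∈ Ico L' L₀, Hg 1 (m + 1 + l) * KL 1 (m + 1) l ≤ ∑ l ∈ Ico L' (L₀ + 1), KL 1 m l) := by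
  refine ⟨fun m L' hL' => ?_, fun m L₀ hL₀ L' hL' => ?_⟩
  · obtain rfl : L' = 0 := by omega
    rw [Nat.Ico_zero_eq_range, range_one, sum_singleton, sum_singleton, M_one hL hh hg hKL hM m, add_zero,
      Hg_one hKL hρ hβnew hβold hH hk2 hkK hL2 (m + 1), ← mul_assoc]
    exact flow_youngest_tail_sum_two_ages hmono hL hb hlo hdom hh hf hg hgF hk2 hkK hL2 hKL hθ m
  · obtain rfl : L₀ = 0 := by omega
    obtain rfl : L' = 0 := by omega
    rw [Ico_self, sum_empty, mul_zero, Nat.Ico_zero_eq_range, range_one, sum_singleton]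
    exact (kernel_entry_le hL hh hg hKL 1 m 0).1

/-! ## §4 The two-age END with the youngest member of (S-b) discharged -/

/-- **ROUTE (N), FIRST ORDER, END FOR TWO-AGE FLOWS — MODULO (S-a), (S-c♯) AND THE OLD AGE'S OWN MEMBERS OF (S-b).**  (E81k)
`flow_nonneg_of_sharp_static_families` for a two-age profile `{1, k}` with the tail-sum hypotheses `hSb`, `hSbp` ASKED ONLY FOR THE AGES `i ≥ 2` — the
age-`1` instances are supplied by `flow_hSb_one`.  (For the silent ages `1 < i < k` and `i > k` every hypothesis is an inequality between zeros; what
genuinely remains of (S-b) is the old age's lone read decay at `i = k`, README `g72/e81` §2.) [folklore] -/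
theorem flow_nonneg_two_ages_of_old_families (hmono : ∀ u v : ℕ → ℝ, SeqBox γ u → SeqBox γ v → (∀ j, u j ≤ v j) → B u ≤ B v)
    (hL : ∀ k, 0 ≤ L k) (hb : 0 < b) (hlo : ∀ u, SeqBox γ u → b ≤ B u) (hdom : ∀ u, SeqBox γ u → ∑ k ∈ range K, L k * u k ≤ B u)
    (hh : SeqBox γ h) (hf : MemFlow B gIR h)
    (hg : ∀ t, 0 < g t ∧ g t ≤ 1) (hgF : ∀ t, 1 / (1 + ∑ k ∈ range K, L k * h (t + k) ^ 3 / 2) ≤ g t)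
    {k : ℕ} (hk2 : 2 ≤ k) (hkK : k < K) (hL2 : ∀ j, j < K → j ≠ 1 → j ≠ k → L j = 0)
    (hKL : ∀ k n l, KL k n l = if 0 < k ∧ k < K ∧ l < k then L k * h (n + k) ^ 3 / 2 * ∏ t ∈ Ico (n + 1 + l) (n + k + 1), g t else 0)
    (hθ : ∀ k n l, θ k n l = 1 - (h (n + k + l) / h (n + k)) ^ 3 * ∏ t ∈ Ico (n + k + 1) (n + k + l + 1), g t)
    {KA : ℕ → ℕ → ℕ → ℝ} {RL RA SL SA : ℕ → (ℕ → ℝ) → ℕ → ℝ}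
    (hRL : ∀ i v m, RL i v m = ∑ l ∈ range K, KL i m l * v (m + 1 + l))
    (hRA : ∀ i v m, RA i v m = ∑ l ∈ range K, KA i m l * v (m + 1 + l))
    (hKA : ∀ i m l, KA i m l = KL i m l + KA (i + 1) m l) (hKAtop : ∀ m l, KA K m l = 0)
    (hSL : ∀ i (w : ℕ → ℝ), (∀ m, K < m → w m = 0) → (∀ m, K < m → SL i w m = 0) ∧ ∀ m, SL i w m = w m - RL i (SL i w) m)
    (hSA : ∀ i (w : ℕ → ℝ), (∀ m, K < m → w m = 0) → (∀ m, K < m → SA i w m = 0) ∧ ∀ m, SA i w m = w m - RA i (SA i w) m)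
    (hρ : ∀ i n, 1 ≤ i → i ≤ K - 1 → ρ i n = (∑ l ∈ range K, KL i n l) * (1 + ∑ k ∈ Ioc i (K - 1), θ k n i * β (i + 1) n k) /
      (1 - ∑ k ∈ Ioc i (K - 1), ∑ l ∈ range i, KL k n l))
    (hβnew : ∀ i n, 1 ≤ i → i ≤ K - 1 → β i n i = ρ i n / (1 - ρ i n))
    (hβold : ∀ i n k, 1 ≤ i → i < k → k ≤ K - 1 → β i n k = β (i + 1) n k / (1 - ρ i n))
    (hrow : ∀ k n, 2 ≤ k → k < K → ∑ l ∈ range k, KL k (n + 1) l ≤ ∑ l ∈ range k, KL k n l)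
    (hH : ∀ i m, Hg i m = (1 + ∑ k ∈ Ioc i (K - 1), θ k m 1 * β (i + 1) m k) / (1 - ∑ k ∈ Ioc i (K - 1), KL k m 0))
    (hM : ∀ i m, M i m = KL i m 0 + ∑ l ∈ range (K - 1), max (KL i m (l + 1) - KL i (m + 1) l) 0)
    (hSb2 : ∀ i m, 2 ≤ i → i ≤ K - 1 → ∀ L', L' < i →
      (1 + M i m) * ∑ l ∈ Ico L' i, Hg i (m + 1 + l) * KL i (m + 1) l ≤ ∑ l ∈ Ico L' i, KL i m l)
    (hSbp2 : ∀ i m, 2 ≤ i → i ≤ K - 1 → ∀ L₀, L₀ < i → ∀ L', L' ≤ L₀ →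
      (1 + M i m) * ∑ l ∈ Ico L' L₀, Hg i (m + 1 + l) * KL i (m + 1) l ≤ ∑ l ∈ Ico L' (L₀ + 1), KL i m l)
    {HgS : ℕ → ℕ → ℕ → ℝ} (hHS : ∀ i j m, HgS i j m = (1 + ∑ k ∈ Ioc i (K - 1), θ k m 1 * β (i + 1) m k) /
      (1 - ∑ k ∈ Ioc i (K - 1), (KL k m 0 - if m + 1 + k ≤ j then KL k (m + 1) (k - 1) else 0)))
    (hSc : ∀ i m j, 1 ≤ i → i ≤ K - 1 → m + 1 + K ≤ j → ∀ L', L' < K →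
      ∑ l ∈ Ico L' K, HgS (i - 1) j (m + 1 + l) * KA i (m + 1) l ≤ ∑ l ∈ Ico L' K, KA i m l)
    (hScp : ∀ i m L₀, 1 ≤ i → i ≤ K - 1 → L₀ < K → ∀ L', L' ≤ L₀ →
      ∑ l ∈ Ico L' L₀, HgS (i - 1) (m + 1 + L₀) (m + 1 + l) * KA i (m + 1) l ≤ ∑ l ∈ Ico L' (L₀ + 1), KA i m l)
    {e ε : ℕ → ℝ} (he0 : ∀ m, 0 ≤ e m) (hea : ∀ m, e (m + 1) ≤ e m) (het : ∀ m, K < m → e m = 0)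
    (hεt : ∀ m, K < m → ε m = 0) (hεrec : ∀ m, ε m = e m - RA 1 ε m) : ∀ m, 0 ≤ ε m := by
  obtain ⟨h1, h1p⟩ := flow_hSb_one hmono hL hb hlo hdom hh hf hg hgF hk2 hkK hL2 hKL hθ hρ hβnew hβold hH hM
  refine flow_nonneg_of_sharp_static_families hmono hL hb hlo hdom hh hf hg hgF (by omega) hKL hθ hRL hRA hKA hKAtop hSL hSA hρ hβnew hβold
    hrow hH hM (fun i m hi1 hiK L' hL' => ?_) (fun i m hi1 hiK L₀ hL₀ L' hL' => ?_) hHS hSc hScp he0 hea het hεt hεrec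
  · rcases Nat.lt_or_ge i 2 with hi | hi
    · obtain rfl : i = 1 := by omega
      exact h1 m L' hL'
    · exact hSb2 i m hi hiK L' hL'
  · rcases Nat.lt_or_ge i 2 with hi | hi
    · obtain rfl : i = 1 := by omega
      exact h1p m L₀ hL₀ L' hL'
    · exact hSbp2 i m hi hiK L₀ hL₀ L' hL'

end Summit.QuantumFields.BalabanUV.Beta.EriceRemainderEnclosureHistoryAutonomyComparisonAgeCompositionYoungestTailSumWiring

end
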